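import Summits.ValiantsHypothesis.ValiantsHypothesis.Theorems.DepthWindowNodeBias

/-!
# Route `DepthWindow` — low-bias trees, calibration rung: the binary interval tree

Cone-free helper (decomp-valiant lens 4, g13) supporting the crux item `HomImmHardTwoOne`
(stmt-ValiantsHypothesis-30635); companion of `DepthWindowNodeBias.lean`.  The trivial end of the depth
ladder, kernel-checked: for every integer word whose prefix sums lie in `[-h, h]` the binary interval tree
(level `t` = dyadic blocks `⌊i/2^t⌋`) is a `LowBiasTree w Δ (4h)` at every depth `Δ` with `d ≤ 2^Δ`
(`lowBiasTree_of_prefix_bounded`, `lowBiasTree_clog`) — the `d`-analogue of LST 2022 Lemma 20.  Words fitting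
`IMM_{n,d}` have prefix overhangs `≤ ⌊log₂ n⌋` bits, so they have node bias `4⌊log₂ n⌋` trees from depth
`log₂ d` on (`lowBiasTree_of_fits`) and, by Prop. 17, NO tree-bias growth there (`not_treeBiasGe_of_fits`):
`LowBiasTree` is satisfiable with bias `O(h)` at logarithmic depth, and the content of the conjecture `ULB_C` of
`DepthWindowNodeBias` is the depth `C·log₂log₂ d`.

References: [LimayeSrinivasanTavenas2022] CCC 2022 (LIPIcs 234:32) Def. 2; full version ECCC TR22-090
Prop. 17, Lemma 20.
-/

-- layout Summits/ValiantsHypothesis/ValiantsHypothesis forces the duplicated namespace component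
set_option linter.dupNamespace false

namespace Summit.ValiantsHypothesis.ValiantsHypothesis.Theorems.DepthWindow.TreeBias

open Finset Literature.Computability.AlgebraicComplexity

variable {d : ℕ}

/-! ### Calibration rung: the binary interval tree (depth `⌈log₂ d⌉`, node bias `4h`) -/

/-- The **binary interval tree** on `Fin d`: level `t` groups the leaves by `⌊i/2^t⌋` (blocks are dyadic
intervals; the single block `⌊i/2^Δ⌋ = 0` on top as soon as `d ≤ 2^Δ`). [folklore] -/
def intervalTree (d : ℕ) : LTree d where
  lab t i := ⟨(i : ℕ) / 2 ^ t, lt_of_le_of_lt (Nat.div_le_self _ _) i.isLt⟩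
  leaf i := Fin.ext (by simp)
  refine t i j hij := by
    apply Fin.ext
    have hij' : (i : ℕ) / 2 ^ t = (j : ℕ) / 2 ^ t := by
      have := congrArg Fin.val hij
      simpa using this
    show (i : ℕ) / 2 ^ (t + 1) = (j : ℕ) / 2 ^ (t + 1)
    rw [pow_succ, ← Nat.div_div_eq_div_mul, ← Nat.div_div_eq_div_mul, hij']

/-- Level `Δ` of the interval tree is a single block once `d ≤ 2^Δ`. [folklore] -/
theorem intervalTree_root {Δ : ℕ} (hΔ : d ≤ 2 ^ Δ) (i j : Fin d) :
    (intervalTree d).lab Δ i = (intervalTree d).lab Δ j := by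
  apply Fin.ext
  show (i : ℕ) / 2 ^ Δ = (j : ℕ) / 2 ^ Δ
  rw [Nat.div_eq_of_lt (lt_of_lt_of_le i.isLt hΔ), Nat.div_eq_of_lt (lt_of_lt_of_le j.isLt hΔ)]

/-- `a / k = b ↔ b·k ≤ a < (b+1)·k` for `k > 0`. [folklore] -/
private theorem nat_div_eq_iff {a b k : ℕ} (hk : 0 < k) : a / k = b ↔ b * k ≤ a ∧ a < (b + 1) * k := by
  rw [← Nat.le_div_iff_mul_le hk, ← Nat.div_lt_iff_lt_mul hk]; omega

/-- Blocks of the interval tree are dyadic intervals, so their sums are differences of two prefix sums.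
[folklore] -/
theorem blockSum_intervalTree (w : Fin d → ℤ) (t : ℕ) (l : Fin d) :
    blockSum w (intervalTree d) t l =
      ∑ j ∈ univ.filter (fun j : Fin d => (j : ℕ) < ((l : ℕ) + 1) * 2 ^ t), w j -
        ∑ j ∈ univ.filter (fun j : Fin d => (j : ℕ) < (l : ℕ) * 2 ^ t), w j := by
  unfold blockSum
  have hsub : (univ.filter fun j : Fin d => (j : ℕ) < (l : ℕ) * 2 ^ t) ⊆
      (univ.filter fun j : Fin d => (j : ℕ) < ((l : ℕ) + 1) * 2 ^ t) := by
    intro j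
    simp only [mem_filter, mem_univ, true_and]
    intro hj
    exact lt_of_lt_of_le hj (Nat.mul_le_mul_right _ (Nat.le_succ _))
  rw [← sum_sdiff_eq_sub hsub]
  refine sum_congr ?_ fun _ _ => rfl
  ext j
  simp only [mem_filter, mem_univ, true_and, mem_sdiff, not_lt, intervalTree, Fin.ext_iff,
    nat_div_eq_iff (Nat.two_pow_pos t)]
  omega

/-- Every internal node of the interval tree has at most two children, each a dyadic interval: if all prefix
sums of `w` lie in `[-h, h]` then every node bias is `≤ 4h`. [folklore] -/
theorem nodeBias_intervalTree_le (w : Fin d → ℤ) (h : ℕ)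
    (hpre : ∀ t : ℕ, |∑ j ∈ univ.filter (fun j : Fin d => (j : ℕ) < t), w j| ≤ h)
    {u : ℕ} (hu : 1 ≤ u) (i : Fin d) : nodeBias w (intervalTree d) u i ≤ ((4 * h : ℕ) : ℤ) := by
  unfold nodeBias
  generalize hS : (univ.filter fun j => (intervalTree d).lab u j = (intervalTree d).lab u i).image
      ((intervalTree d).lab (u - 1)) = S
  have hterm : ∀ l ∈ S, |blockSum w (intervalTree d) (u - 1) l| ≤ ((2 * h : ℕ) : ℤ) := by
    intro l _
    rw [blockSum_intervalTree]
    have h1 := hpre (((l : ℕ) + 1) * 2 ^ (u - 1))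
    have h2 := hpre ((l : ℕ) * 2 ^ (u - 1))
    have h3 := abs_sub (∑ j ∈ univ.filter (fun j : Fin d => (j : ℕ) < ((l : ℕ) + 1) * 2 ^ (u - 1)), w j)
      (∑ j ∈ univ.filter (fun j : Fin d => (j : ℕ) < (l : ℕ) * 2 ^ (u - 1)), w j)
    push_cast
    linarith
  have hcard : S.card ≤ 2 := by
    have hpow : 2 ^ u = 2 ^ (u - 1) * 2 := by
      rw [← pow_succ]; congr 1; omega
    have hle : S.card ≤ (Icc (2 * ((i : ℕ) / 2 ^ u)) (2 * ((i : ℕ) / 2 ^ u) + 1)).card := by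
      refine card_le_card_of_injOn (fun l => (l : ℕ)) ?_ (Set.injOn_of_injective Fin.val_injective)
      intro l hl
      have hl' : l ∈ S := by simpa using hl
      rw [← hS, mem_image] at hl'
      obtain ⟨j, hj, rfl⟩ := hl'
      rw [mem_filter] at hj
      have hj' : (j : ℕ) / 2 ^ u = (i : ℕ) / 2 ^ u := by
        have := congrArg Fin.val hj.2
        simpa [intervalTree] using this
      have hj'' : (j : ℕ) / 2 ^ (u - 1) / 2 = (i : ℕ) / 2 ^ u := by
        rw [Nat.div_div_eq_div_mul, ← hpow]; exact hj'
      simp only [coe_Icc, Set.mem_Icc, intervalTree]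
      omega
    rw [Nat.card_Icc] at hle
    omega
  calc ∑ l ∈ S, |blockSum w (intervalTree d) (u - 1) l| ≤ ∑ l ∈ S, ((2 * h : ℕ) : ℤ) := sum_le_sum hterm
    _ = S.card • ((2 * h : ℕ) : ℤ) := sum_const _
    _ ≤ 2 • ((2 * h : ℕ) : ℤ) := nsmul_le_nsmul_left (by positivity) hcard
    _ = ((4 * h : ℕ) : ℤ) := by push_cast; ring

/-- **Rung (trivial end of the ladder).**  If all prefix sums of `w` lie in `[-h, h]`, the interval tree is a
`LowBiasTree w Δ (4h)` at every depth `Δ` with `d ≤ 2^Δ` — the `d`-analogue of LST 2022 Lemma 20 (depth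
`log` of the error suffices for bounded bias); `ULB_C` asks for the same at depth `C·log₂log₂ d`.
[cite: LimayeSrinivasanTavenas2022, Lemma 20] -/
theorem lowBiasTree_of_prefix_bounded (w : Fin d → ℤ) (h : ℕ)
    (hpre : ∀ t : ℕ, |∑ j ∈ univ.filter (fun j : Fin d => (j : ℕ) < t), w j| ≤ h) {Δ : ℕ}
    (hΔ : d ≤ 2 ^ Δ) : LowBiasTree w Δ ((4 * h : ℕ) : ℤ) :=
  ⟨intervalTree d, intervalTree_root hΔ, fun _ hu _ i => nodeBias_intervalTree_le w h hpre hu i⟩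

/-- The same at depth `⌈log₂ d⌉`. [cite: LimayeSrinivasanTavenas2022, Lemma 20] -/
theorem lowBiasTree_clog (w : Fin d → ℤ) (h : ℕ)
    (hpre : ∀ t : ℕ, |∑ j ∈ univ.filter (fun j : Fin d => (j : ℕ) < t), w j| ≤ h) :
    LowBiasTree w (Nat.clog 2 d) ((4 * h : ℕ) : ℤ) :=
  lowBiasTree_of_prefix_bounded w h hpre (Nat.le_pow_clog one_lt_two d)

/-- Words fitting `IMM_{n,d}` (prefix overhangs `≤ ⌊log₂ n⌋` bits) have low-bias trees of node bias
`4⌊log₂ n⌋` at every depth `Δ ≥ log₂ d`. [cite: LimayeSrinivasanTavenas2022, Def. 2, Lemma 20] -/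
theorem lowBiasTree_of_fits (sz : Fin d → ℕ) (pos : Fin d → Bool) {n : ℕ}
    (hfit : ∀ t ≤ d, 2 ^ GenWord.overLen sz pos t ≤ n) {Δ : ℕ} (hΔ : d ≤ 2 ^ Δ) :
    LowBiasTree (GenWord.wt sz pos) Δ ((4 * Nat.log 2 n : ℕ) : ℤ) := by
  refine lowBiasTree_of_prefix_bounded _ _ (fun t => ?_) hΔ
  have key : ∀ s ≤ d, |∑ j ∈ univ.filter (fun j : Fin d => (j : ℕ) < s), GenWord.wt sz pos j| ≤
      (Nat.log 2 n : ℤ) := by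
    intro s hs
    have h := Nat.le_log_of_pow_le one_lt_two (hfit s hs)
    rw [GenWord.overLen_eq_natAbs sz pos s hs] at h
    unfold GenWord.wsum at h
    rw [Int.abs_eq_natAbs]
    exact_mod_cast h
  rcases le_or_gt t d with ht | ht
  · exact key t ht
  · have hft : (univ.filter fun j : Fin d => (j : ℕ) < t) = (univ.filter fun j : Fin d => (j : ℕ) < d) := by
      ext j
      simp only [mem_filter, mem_univ, true_and]
      exact ⟨fun _ => j.isLt, fun _ => lt_trans j.isLt ht⟩
    rw [hft]
    exact key d le_rfl

/-- Hence NO fitting word has depth-`Δ` tree bias above `4Δ⌊log₂ n⌋` once `2^Δ ≥ d`: growth of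
`Treebias/(Δ·log n)` — what `TreeBiasGrowthAt` asks below depth `a·L₃` — is impossible from depth `log₂ d`
on (the trivial end of the depth ladder; `ULB_2` conjecturally moves this end down to `2·log₂log₂ d`).
[cite: LimayeSrinivasanTavenas2022, Prop. 17, Lemma 20] -/
theorem not_treeBiasGe_of_fits {sz : Fin d → ℕ} {pos : Fin d → Bool} {n : ℕ}
    (hfit : ∀ t ≤ d, 2 ^ GenWord.overLen sz pos t ≤ n) {Δ : ℕ} (hΔ : d ≤ 2 ^ Δ) {τ : ℕ}
    (hτ : Δ * (4 * Nat.log 2 n) < τ) : ¬ TreeBiasGe (GenWord.wt sz pos) Δ τ :=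
  not_treeBiasGe_of_lowBiasTree (lowBiasTree_of_fits sz pos hfit hΔ) (by exact_mod_cast hτ)

end Summit.ValiantsHypothesis.ValiantsHypothesis.Theorems.DepthWindow.TreeBias
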